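import Literature.Topology.PlaneTopology.JordanSweepParity
import Literature.Topology.PlaneTopology.RectangleDuality
import HarnessLib

/-!
# A Jordan loop separating two horizontal crossings of a chart rectangle crosses it horizontally

Topic `Literature/Topology/PlaneTopology`; proofs only. Let `Λ` be a Jordan loop
(`IsJordanLoop`), `Φ` a homeomorphism of the plane (a chart), and `R = [a, b] × [c, d]` a
rectangle in the chart. Suppose two continua `K_A, K_B ⊆ R`, each meeting both vertical sides of
`R`, are mapped by `Φ` to the inside, respectively the outside, of `Λ`. Then **some connected
subset of `Φ⁻¹(trace Λ) ∩ R` meets both vertical sides of `R`**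
(`IsJordanLoop.exists_isPreconnected_crossing_of_separated`). Proof: otherwise the continuum
half of planar duality in a rectangle (`exists_path_avoiding_of_not_crossed`) gives a path in `R`
from the bottom side to the top side missing `Φ⁻¹(trace Λ)`; by the crossing lemma
(`exists_mem_of_isPreconnected_crossing`) it meets `K_A` and `K_B`, and the image under `Φ` of its
stretch between the two meeting times is a connected set off the trace containing an inside and an
outside point, contradicting `IsJordanLoop.subset_inside_or_subset_outside`. This is the
topological step by which a cluster interface separating a primal from a dual crossing of a quad is
shown to contain a crossing of the quad (Camia–Newman 2006 §5; Garban–Pete–Schramm 2013 §2.3).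

## References

* O. Schramm, S. Smirnov, Ann. Probab. 39 (2011), proof of Lemma 6.1 [SchrammSmirnov2011].
* F. Camia, C. M. Newman, Comm. Math. Phys. 268 (2006), §5 [CamiaNewman2006].
-/

noncomputable section

namespace Literature.Topology.PlaneTopology

open Complex Set Metric Function

namespace IsJordanLoop

/-- **A Jordan loop separating two horizontal crossings of a chart rectangle crosses it
horizontally.** See the module docstring. [cite: SchrammSmirnov2011, proof of Lemma 6.1] -/
theorem exists_isPreconnected_crossing_of_separated {Λ : ℝ → ℂ} (hΛ : IsJordanLoop Λ)
    (Φ : ℂ ≃ₜ ℂ) {a b c d : ℝ} (hab : a < b) (hcd : c < d) {KA KB : Set ℂ}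
    (hKA : IsCompact KA) (hKAc : IsPreconnected KA) (hKAsub : KA ⊆ Icc a b ×ℂ Icc c d)
    (hKAa : ∃ z ∈ KA, z.re = a) (hKAb : ∃ z ∈ KA, z.re = b) (hA : Φ '' KA ⊆ inside Λ)
    (hKB : IsCompact KB) (hKBc : IsPreconnected KB) (hKBsub : KB ⊆ Icc a b ×ℂ Icc c d)
    (hKBa : ∃ z ∈ KB, z.re = a) (hKBb : ∃ z ∈ KB, z.re = b) (hB : Φ '' KB ⊆ outside Λ) :
    ∃ C ⊆ Φ.symm '' range Λ ∩ Icc a b ×ℂ Icc c d, IsPreconnected C ∧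
      (∃ z ∈ C, z.re = a) ∧ ∃ z ∈ C, z.re = b := by
  by_contra hno
  push Not at hno
  set 𝒦 : Set ℂ := Φ.symm '' range Λ ∩ Icc a b ×ℂ Icc c d with h𝒦
  have h𝒦c : IsCompact 𝒦 :=
    (hΛ.isCompact_range.image Φ.symm.continuous).inter_right (isClosed_Icc.reProdIm isClosed_Icc)
  obtain ⟨g, hgc, hgR, hg0, hg1, hg𝒦⟩ := exists_path_avoiding_of_not_crossed hab hcd h𝒦c
    inter_subset_right fun C hC hCc hCa hCb ↦ by
      obtain ⟨z, hz, hzb⟩ := hCb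
      exact hno C hC hCc hCa z hz hzb
  -- the path meets both continua
  obtain ⟨tA, htA, hgA⟩ := exists_mem_of_isPreconnected_crossing hab.le hcd.le hKA hKAc hKAsub hKAa hKAb
    hgc hgR hg0 hg1
  obtain ⟨tB, htB, hgB⟩ := exists_mem_of_isPreconnected_crossing hab.le hcd.le hKB hKBc hKBsub hKBa hKBb
    hgc hgR hg0 hg1
  -- the stretch of the path between the two meeting times, pushed forward by `Φ`
  set S : Set ℂ := (fun t ↦ Φ (g t)) '' uIcc tA tB with hS
  have hsubI : uIcc tA tB ⊆ Icc (0 : ℝ) 1 := uIcc_subset_Icc htA htB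
  have hSc : IsPreconnected S :=
    isPreconnected_uIcc.image _ ((Φ.continuous.comp_continuousOn hgc).mono hsubI)
  have hSoff : S ⊆ (range Λ)ᶜ := by
    rintro _ ⟨t, ht, rfl⟩ hmem
    refine hg𝒦 t (hsubI ht) ⟨?_, hgR (hsubI ht)⟩
    exact ⟨Φ (g t), hmem, Φ.symm_apply_apply _⟩
  have hAS : Φ (g tA) ∈ S := ⟨tA, left_mem_uIcc, rfl⟩
  have hBS : Φ (g tB) ∈ S := ⟨tB, right_mem_uIcc, rfl⟩
  have hAin : Φ (g tA) ∈ inside Λ := hA ⟨g tA, hgA, rfl⟩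
  have hBout : Φ (g tB) ∈ outside Λ := hB ⟨g tB, hgB, rfl⟩
  rcases hΛ.subset_inside_or_subset_outside hSc hSoff with hin | hout
  · exact Set.disjoint_left.1 disjoint_inside_outside (hin hBS) hBout
  · exact Set.disjoint_left.1 disjoint_inside_outside hAin (hout hAS)

/-- **Transposed form**: continua meeting the two horizontal sides of the chart rectangle, one
mapped inside and one outside the Jordan loop, force a connected subset of `Φ⁻¹(trace Λ) ∩ R`
meeting both horizontal sides (apply the previous theorem to the chart composed with the
reflection `z ↦ i·conj z`-free transposition `(x, y) ↦ (y, x)`). [cite: SchrammSmirnov2011, proof of Lemma 6.1] -/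
theorem exists_isPreconnected_crossing_of_separated' {Λ : ℝ → ℂ} (hΛ : IsJordanLoop Λ)
    (Φ : ℂ ≃ₜ ℂ) {a b c d : ℝ} (hab : a < b) (hcd : c < d) {KA KB : Set ℂ}
    (hKA : IsCompact KA) (hKAc : IsPreconnected KA) (hKAsub : KA ⊆ Icc a b ×ℂ Icc c d)
    (hKAc' : ∃ z ∈ KA, z.im = c) (hKAd : ∃ z ∈ KA, z.im = d) (hA : Φ '' KA ⊆ inside Λ)
    (hKB : IsCompact KB) (hKBc : IsPreconnected KB) (hKBsub : KB ⊆ Icc a b ×ℂ Icc c d)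
    (hKBc' : ∃ z ∈ KB, z.im = c) (hKBd : ∃ z ∈ KB, z.im = d) (hB : Φ '' KB ⊆ outside Λ) :
    ∃ C ⊆ Φ.symm '' range Λ ∩ Icc a b ×ℂ Icc c d, IsPreconnected C ∧
      (∃ z ∈ C, z.im = c) ∧ ∃ z ∈ C, z.im = d := by
  -- the transposition `x + iy ↦ y + ix` as a homeomorphism
  set τ : ℂ ≃ₜ ℂ :=
    { toFun := fun z ↦ (z.im : ℂ) + (z.re : ℂ) * Complex.I
      invFun := fun z ↦ (z.im : ℂ) + (z.re : ℂ) * Complex.I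
      left_inv := fun z ↦ by apply Complex.ext <;> simp
      right_inv := fun z ↦ by apply Complex.ext <;> simp
      continuous_toFun := by fun_prop
      continuous_invFun := by fun_prop } with hτ
  have hτre : ∀ z, (τ z).re = z.im := fun z ↦ by simp [hτ]
  have hτim : ∀ z, (τ.symm z).im = z.re := fun z ↦ by simp [hτ, Homeomorph.symm]
  have hτre' : ∀ z, (τ.symm z).re = z.im := fun z ↦ by simp [hτ, Homeomorph.symm]
  have hτim' : ∀ z, (τ z).im = z.re := fun z ↦ by simp [hτ]
  have hτrect : ∀ {z : ℂ}, z ∈ Icc a b ×ℂ Icc c d → τ z ∈ Icc c d ×ℂ Icc a b := by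
    intro z hz
    rw [mem_reProdIm] at hz ⊢
    rw [hτre, hτim']
    exact ⟨hz.2, hz.1⟩
  have hτrect' : ∀ {z : ℂ}, z ∈ Icc c d ×ℂ Icc a b → τ.symm z ∈ Icc a b ×ℂ Icc c d := by
    intro z hz
    rw [mem_reProdIm] at hz ⊢
    rw [hτre', hτim]
    exact ⟨hz.2, hz.1⟩
  -- transport the data by `τ` and apply the horizontal form with the chart `Φ ∘ τ⁻¹`
  obtain ⟨C, hCsub, hCc, ⟨zc, hzc, hzcre⟩, ⟨zd, hzd, hzdre⟩⟩ :=
    exists_isPreconnected_crossing_of_separated hΛ (τ.symm.trans Φ) hcd hab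
      (hKA.image τ.continuous) (hKAc.image _ τ.continuous.continuousOn)
      (by rintro _ ⟨z, hz, rfl⟩; exact hτrect (hKAsub hz))
      (by obtain ⟨z, hz, h⟩ := hKAc'; exact ⟨τ z, mem_image_of_mem _ hz, by rw [hτre, h]⟩)
      (by obtain ⟨z, hz, h⟩ := hKAd; exact ⟨τ z, mem_image_of_mem _ hz, by rw [hτre, h]⟩)
      (by rintro _ ⟨_, ⟨z, hz, rfl⟩, rfl⟩
          simp only [Homeomorph.trans_apply, Homeomorph.symm_apply_apply]
          exact hA ⟨z, hz, rfl⟩)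
      (hKB.image τ.continuous) (hKBc.image _ τ.continuous.continuousOn)
      (by rintro _ ⟨z, hz, rfl⟩; exact hτrect (hKBsub hz))
      (by obtain ⟨z, hz, h⟩ := hKBc'; exact ⟨τ z, mem_image_of_mem _ hz, by rw [hτre, h]⟩)
      (by obtain ⟨z, hz, h⟩ := hKBd; exact ⟨τ z, mem_image_of_mem _ hz, by rw [hτre, h]⟩)
      (by rintro _ ⟨_, ⟨z, hz, rfl⟩, rfl⟩
          simp only [Homeomorph.trans_apply, Homeomorph.symm_apply_apply]
          exact hB ⟨z, hz, rfl⟩)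
  refine ⟨τ.symm '' C, ?_, hCc.image _ τ.symm.continuous.continuousOn,
    ⟨τ.symm zc, mem_image_of_mem _ hzc, ?_⟩, ⟨τ.symm zd, mem_image_of_mem _ hzd, ?_⟩⟩
  · rintro _ ⟨z, hz, rfl⟩
    obtain ⟨⟨w, hw, hwz⟩, hzR⟩ := hCsub hz
    refine ⟨⟨w, hw, ?_⟩, hτrect' hzR⟩
    rw [← hwz, Homeomorph.symm_trans_apply, Homeomorph.symm_symm, Homeomorph.symm_apply_apply]
  · rw [hτim, hzcre]
  · rw [hτim, hzdre]

end IsJordanLoop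

end Literature.Topology.PlaneTopology

end
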